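import Mathlib
import Summits.NavierStokesRegularity.NavierStokesRegularity.Theses.UnthreadedDoor
import Summits.NavierStokesRegularity.NavierStokesRegularity.Theorems.UnthreadedDoorUnthreadedZoom
import Summits.NavierStokesRegularity.NavierStokesRegularity.Theorems.UnthreadedDoorShiftedPoloidalClass
import Summits.NavierStokesRegularity.NavierStokesRegularity.Theorems.UnthreadedDoorConstantSliceExtinction
import Summits.NavierStokesRegularity.NavierStokesRegularity.Theorems.UnthreadedDoorIndicatrixTypeIHalfOfResidue
import HarnessLib

/-!
# TargetOfTypeIHalf — the UnthreadedDoor `Target` needs only the TYPE-I HALF C⁻ of `PoloidalLiouville` (1222)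

Theorems-side landing (ns-wall-eng-4 g10, NS STEWARD word p128 2026-08-29T16:32:34Z; `--supports stmt-NavierStokesRegularity-1222 --as helper`,
theorem-only, 0 kit) of the custodian's planner workfile `Cruxes/PoloidalLiouville/TargetOfTypeIHalf.lean` (ns-idea-14 g13, commit 1607a04f48e6,
sha16 ddd970b5eb81d6de; hub rc 0 · 0 sorry, kernel-confirmed by ns-wall-crit-1 g8 BATCH #45) — statements and proofs VERBATIM; only this header
sentence, the `E3` binder (the tree's `NetFlux.E3` abbrev opened by name instead of a `local notation`) and the docstring of the shift lemma differ.

OBSERVATION.  The route's deciding theorem `Theses.UnthreadedDoor.closes (hZ) (hS) (hP : PoloidalLiouville) (hE) : Target` applies `hP` only to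
the time-shifted zoom limit `fun s x => v (s - δ) x` (`δ = -t/2 > 0`) of a `v` carrying `HasTypeITimeDecay C v` (output of `UnthreadedZoom`, item
27411, proved).  Type-I time decay survives the backward shift (`hasTypeITimeDecay_shift`), so the Type-I half C⁻ of W1 — the statement
`∀ v, ((∃ C, HasTypeITimeDecay C v) ∧ IsBoundedAncientMildSolution 1 v ∧ measurable ∧ C^∞ on the slab ∧ ∃ x₀, unthreaded about x₀) → constant
slices`, i.e. the conclusion of `Theorems.PoloidalLiouville.Indicatrix.poloidalLiouvilleTypeI_of_indicatrixResidue` (ARM A g8, p731994) verbatim —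
ALONE gives `Target`: `unthreadedDoor_target_of_poloidalLiouvilleTypeI`.  Composed with p731994 (the `example` at the end elaborates):

  **`UnthreadedDoor.Target` ⟸ {`VandendriesMiller1994_realAnExp_isOMinimal` (registered fact), Λ-1 `HeadClusterRuleTame`, Λ-2 `ClusterFluxOneSidedLawTame`,
  Λ-0b+c `IndicatrixLeHessian`, Σ-0bR₂ `ClusterFluxNearCentreLipschitz`} BY NAME** — four M-sized OPEN statements (IndicatrixSketch v1.7.8 §3) instead of the
  XL wall W1 as typed (⟨1222⟩ also covers non-Type-I ancient solutions, which this route never meets).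

CONSEQUENCE (a TENURE / director decision, not mine — this seat opens/edits no routes): the route could be re-glued (`ledger route edit
route-NavierStokesRegularity-UnthreadedDoor --closes-file …`) with C⁻ — or directly its four residue items — as the load-bearing binders in place of `hP`.
HONEST LABEL: bookkeeping; `Target` (rung N0-LocalTubeDoorUnthreaded, a LOCAL Type-I door statement) is NOT proved — it is proved CONDITIONALLY on the
four open items + one registered fact; ⟨1222⟩ `PoloidalLiouville` stays OPEN and is NOT implied by C⁻; NS regularity is NOT proved.
-/

noncomputable section

set_option linter.dupNamespace false

namespace Summit.NavierStokesRegularity.NavierStokesRegularity.Theorems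

open Summit.NavierStokesRegularity.NavierStokesRegularity.Theses.UnthreadedDoor
open Literature.Analysis.FluidPDE MeasureTheory

open Summit.NavierStokesRegularity.NavierStokesRegularity.Theorems.PoloidalLiouville.NetFlux (E3)

/-- Type-I time decay survives a backward time shift `s ↦ v (s - δ)`, `δ ≥ 0` (`√(−s) ≤ √(−(s − δ))`; the pure-decay conjunct of the bundled
`Theorems.timeShift_class` of `HalfSpaceWindowDoorCirculationCarryingRigidityCriticalStretchingAnalytic`, stated for the `s − δ` form used by
`Theses.UnthreadedDoor.closes`). [folklore] -/
theorem hasTypeITimeDecay_shift {C δ : ℝ} {v : ℝ → E3 → E3} (hv : HasTypeITimeDecay C v) (hδ : 0 ≤ δ) :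
    HasTypeITimeDecay C (fun s x => v (s - δ) x) := by
  intro s hs x
  have hsδ : s - δ < 0 := by linarith
  have h := hv (s - δ) hsδ x
  have hC : 0 ≤ C := by
    have h0 := hv (-1) (by norm_num) 0
    have : (0 : ℝ) ≤ C / Real.sqrt (-(-1 : ℝ)) := le_trans (norm_nonneg _) h0
    simpa using this
  calc ‖v (s - δ) x‖ ≤ C / Real.sqrt (-(s - δ)) := h
    _ ≤ C / Real.sqrt (-s) := by
        apply div_le_div_of_nonneg_left hC (Real.sqrt_pos.mpr (by linarith))
        exact Real.sqrt_le_sqrt (by linarith)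

/-- **C⁻ (the Type-I poloidal Liouville) alone gives the door's `Target`** — the route's `closes` verbatim, with the
Type-I decay of the shifted zoom limit supplied. -/
theorem unthreadedDoor_target_of_poloidalLiouvilleTypeI
    (hP : ∀ v : ℝ → E3 → E3,
      ((∃ C : ℝ, HasTypeITimeDecay C v) ∧ IsBoundedAncientMildSolution 1 v ∧
        (∀ t < 0, AEStronglyMeasurable (v t) volume) ∧
        ContDiffOn ℝ (⊤ : ℕ∞) (Function.uncurry v) (Set.Iio 0 ×ˢ Set.univ) ∧
        ∃ x₀ : E3, ∀ t < 0, ∀ x, inner ℝ (x - x₀) (curl (v t) x) = 0) →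
      ∀ t < 0, ∃ b : E3, ∀ x, v t x = b) :
    Target := by
  intro ν T hν hT u p hcl hLH hdec x₀ ρ M hρ hwin hfade
  by_contra hbb
  obtain ⟨C, v, ⟨hdecay, hcont, hmild, hdiv⟩, hsing, htor⟩ :=
    unthreadedDoor_unthreadedZoom_proof ν T hν hT u p hcl hLH hdec x₀ ρ M hρ hwin hfade hbb
  refine unthreadedDoor_constantSliceExtinction_proof C v hdecay hcont hmild hdiv ?_ hsing
  intro t ht
  have hδ : 0 < -t / 2 := by linarith
  obtain ⟨h1, h2, h3, h4⟩ := unthreadedDoor_shiftedPoloidalClass_proof C v hdecay hcont hmild hdiv htor (-t / 2) hδ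
  obtain ⟨b, hb⟩ := hP (fun s x => v (s - -t / 2) x)
    ⟨⟨C, hasTypeITimeDecay_shift hdecay hδ.le⟩, h1, h2, h3, ⟨0, h4⟩⟩ (t / 2) (by linarith)
  refine ⟨b, fun x => ?_⟩
  have hx := hb x
  have ht' : t / 2 - -t / 2 = t := by ring
  simp only [ht'] at hx
  exact hx

/-- **The door's `Target` BY NAME modulo the five named residue items of C⁻** (p731994): composition check. -/
example := fun hO h1 h2 hb hR₂ =>
  unthreadedDoor_target_of_poloidalLiouvilleTypeI
    (PoloidalLiouville.Indicatrix.poloidalLiouvilleTypeI_of_indicatrixResidue hO h1 h2 hb hR₂)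

end Summit.NavierStokesRegularity.NavierStokesRegularity.Theorems

end
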